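import Literature.RepresentationTheory.TwistedCoinvariantsCompactEigenvector
import Mathlib.Algebra.Group.AddChar
import Mathlib.GroupTheory.GroupAction.Quotient
import HarnessLib

/-!
# Every character of a compact group occurs when it normalises an abelian group with a free orbit of eigencharacters

Topic `RepresentationTheory`; namespace `Literature.RepresentationTheory.TwistedCoinv` (continuing
`TwistedCoinvariants`, `TwistedCoinvariantsCompactEigenvector`).  KERNEL ONLY: theorems, 0 definitions, 0 records,
0 named facts, 0 sorry.

The MACKEY-TYPE OCCURRENCE ARGUMENT behind the stable-range lemma of the theta correspondence
([MoeglinVignerasWaldspurger1987, Chap. 3 §IV.2 Lemme, p. 76]: «Tout `π ∈ Irr(H_m)~` est quotient de `ω_{m,n}`»; for a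
COMPACT member `H = U(W)`, `dim W = 1`, its proof — mixed model `𝒮(X'* ⊗ W) ⊗ S°` and evaluation along an orbit —
says: the Weil representation restricted to `U(W)` contains the regular representation of the compact torus, because
`U(W)` normalises the abelian group of an isotropic line and acts FREELY on its non-trivial characters), isolated as
pure representation theory:

Let `Z` be a compact group acting smoothly on a `k`-space `S` (`M`, `char k = 0`), `χ : Z →* kˣ` with open kernel.
Suppose given operators `ρ_c ∈ End S` indexed by an additive group `L`, an additive character `θ` of `L` and a linear
form `μ` on `S` which is a `θ`-EIGENFUNCTIONAL (`μ (ρ_c φ) = θ(c) μ φ`) not vanishing at `φ₀`, and subgroups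
`C₀, C ≤ L` with `C ⧸ (C ∩ C₀)` finite and `C₀ ≤ ker θ`, such that every `z ∈ Z` normalises the family
through an additive map `γ_z` preserving `C₀` (`M_z ρ_c = ρ_{γ_z c} M_z`) and EITHER fixes `φ₀` with `χ z = 1` OR moves
`θ` on `C` (`θ (γ_z c) ≠ θ c` for some `c ∈ C` — the orbit of `θ` is free «away from the stabiliser of `φ₀`»).  THEN
`χ` OCCURS in `S`: there is a non-zero `φ` with `M_z φ = χ(z) φ` for all `z` (`exists_eigenvector_of_free_orbit`), hence
the `χ`-coinvariants `Coinv M χ` are non-zero (`nontrivial_coinv_of_free_orbit`, via `mk_ne_zero_of_eigenvector`).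

Proof (§1 algebra, §2 topology): the test vector `φ' = Σ_{c ∈ C/C₀} θ(c)⁻¹ ρ_c φ₀` satisfies
`μ (M_z φ') = [Σ_{c ∈ C/C₀} θ(γ_z c) θ(c)⁻¹] · μ (M_z φ₀)`, a character sum over the finite group `C ⧸ C₀` which
VANISHES unless `θ ∘ γ_z = θ` on `C`, in which case `z` fixes `φ₀` and `χ z = 1`; averaging `φ'` against `χ⁻¹` over
`Z ⧸ U` (`U` a finite-index subgroup inside `ker χ` fixing `φ₀` and `φ'`; left cosets suffice, no normality) gives a
`χ`-eigenvector `φ` with `μ φ = |C/C₀| · μ φ₀ · #{cosets meeting the stabiliser} ≠ 0`.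

Consumer: `MoeglinVignerasWaldspurger1987/RankOneThetaLiftNonvanishingProofs.lean` (the theta lift of every character
of `U(1)` to `U(V)`, `V` isotropic, is non-zero), with `Z = E_v¹`, `L = E_v` parametrising an isotropic `E_v`-line of
`Res_{E_v/F_v} V`, `ρ` the Schrödinger model on that line, `μ` a Gaussian integral on `𝒮(F_vᴺ)`.

## References
* [MoeglinVignerasWaldspurger1987] C. Mœglin, M.-F. Vignéras, J.-L. Waldspurger, *Correspondances de Howe sur un corps
  p-adique*, LNM 1291 (1987), Chap. 3 §IV.2 Lemme and its proof (p. 76).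
* [BernsteinZelevinsky1976] I. N. Bernstein, A. V. Zelevinsky, Russian Math. Surveys 31 (1976), §2.1–2.3 (smooth
  representations of compact totally disconnected groups are semisimple; isotypic components).
-/

set_option autoImplicit false

noncomputable section

open scoped BigOperators

namespace Literature.RepresentationTheory.TwistedCoinv

/-! ## §1. Algebra -/

section Algebra

variable {k : Type*} [Field k] {Z : Type*} [Group Z] {S : Type*} [AddCommGroup S] [Module k S]
  (M : Representation k Z S) (χ : Z →* kˣ)

/-- **averaging against `χ⁻¹` over left cosets produces `χ`-eigenvectors**: for a subgroup `U ≤ ker χ` of finite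
index fixing `φ`, the vector `Σ_{r ∈ Z/U} χ(r̃)⁻¹ • M(r̃) φ` (`r̃ = r.out`) is a `(Z, χ)`-eigenvector (reindex the
cosets by `r ↦ z • r`; no normality of `U` is needed). [cite: BernsteinZelevinsky1976, §2.3] -/
theorem apply_sum_smul_out_eq_smul (U : Subgroup Z) [Fintype (Z ⧸ U)] (hUχ : U ≤ χ.ker) {φ : S}
    (hUφ : ∀ u ∈ U, M u φ = φ) (z : Z) :
    M z (∑ r : Z ⧸ U, (((χ r.out)⁻¹ : kˣ) : k) • M r.out φ) =
      ((χ z : kˣ) : k) • ∑ r : Z ⧸ U, (((χ r.out)⁻¹ : kˣ) : k) • M r.out φ := by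
  classical
  -- `M z` applied to the `r`-th summand is `χ z •` the `(z • r)`-th summand
  have hterm : ∀ r : Z ⧸ U, M z ((((χ r.out)⁻¹ : kˣ) : k) • M r.out φ) =
      ((χ z : kˣ) : k) • ((((χ (z • r).out)⁻¹ : kˣ) : k) • M (z • r).out φ) := by
    intro r
    obtain ⟨u, hu⟩ := QuotientGroup.mk_out_eq_mul U (z * r.out)
    have hzr : (z • r : Z ⧸ U) = QuotientGroup.mk (z * r.out) := by
      rw [← MulAction.Quotient.coe_smul_out, smul_eq_mul]
    have hout : (z • r : Z ⧸ U).out = z * r.out * u := by rw [hzr]; exact hu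
    have hMu : M (u : Z) φ = φ := hUφ u u.2
    have hχu : χ (u : Z) = 1 := hUχ u.2
    have hk : (((χ r.out)⁻¹ : kˣ) : k) = ((χ z : kˣ) : k) * (((χ (z * r.out * u))⁻¹ : kˣ) : k) := by
      rw [map_mul, map_mul, hχu, mul_one, ← Units.val_mul, mul_inv_rev, mul_inv_cancel_comm_assoc]
    rw [hout, map_smul, smul_smul, ← hk, map_mul M, map_mul M, Module.End.mul_apply, hMu, Module.End.mul_apply]
  rw [map_sum, Finset.smul_sum]
  simp_rw [hterm]
  exact Fintype.sum_equiv (MulAction.toPerm z) _ _ fun r => rfl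

/-- values of an additive character into a field are non-zero. [folklore] -/
private theorem addChar_apply_ne_zero {L : Type*} [AddCommGroup L] (θ : AddChar L k) (c : L) : θ c ≠ 0 :=
  (θ.val_isUnit c).ne_zero

open scoped Classical in
/-- a character sum over a finite quotient: if `η : C → k` turns sums into products on the subgroup `C` and is
trivial on `C₀ ≤ C`, then `Σ_{q ∈ C/C₀} η(q.out)` is `|C/C₀|` if `η = 1` on `C` and `0` otherwise. [folklore] -/
private theorem sum_out_eq {L : Type*} [AddCommGroup L] (C : AddSubgroup L) (C₀ : AddSubgroup C)
    [Fintype (C ⧸ C₀)] (η : C → k) (hadd : ∀ a b : C, η (a + b) = η a * η b) (hC₀ : ∀ c ∈ C₀, η c = 1) :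
    (∑ q : C ⧸ C₀, η q.out) = if ∀ c : C, η c = 1 then (Fintype.card (C ⧸ C₀) : k) else 0 := by
  classical
  split_ifs with h
  · simp only [h, Finset.sum_const, Finset.card_univ, nsmul_eq_mul, mul_one]
  · obtain ⟨c₁, hc₁⟩ := not_forall.1 h
    -- `η` is constant on cosets of `C₀`
    have hcoset : ∀ a : C, η ((QuotientAddGroup.mk a : C ⧸ C₀).out) = η a := by
      intro a
      obtain ⟨h₀, hh₀⟩ := QuotientAddGroup.mk_out_eq_mul C₀ a
      rw [hh₀, hadd, hC₀ h₀ h₀.2, mul_one]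
    -- translate the cosets by `c₁`
    have hre : ∀ q : C ⧸ C₀, η (c₁ +ᵥ q).out = η c₁ * η q.out := by
      intro q
      have hq : (c₁ +ᵥ q : C ⧸ C₀) = QuotientAddGroup.mk (c₁ + q.out) := by
        rw [← AddAction.Quotient.coe_vadd_out, vadd_eq_add]
      rw [hq, hcoset, hadd]
    have hsum : (∑ q : C ⧸ C₀, η q.out) = η c₁ * ∑ q : C ⧸ C₀, η q.out := by
      rw [Finset.mul_sum]
      simp_rw [← hre]
      exact (Fintype.sum_equiv (AddAction.toPerm c₁) _ _ fun q => rfl).symm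
    -- `η c₁ ≠ 1` forces the sum to vanish
    have h1 : (1 - η c₁) * ∑ q : C ⧸ C₀, η q.out = 0 := by rw [sub_mul, one_mul, ← hsum, sub_self]
    rcases mul_eq_zero.1 h1 with h2 | h2
    · exact absurd (sub_eq_zero.1 h2).symm hc₁
    · exact h2

variable [CharZero k]

/-- **Algebraic occurrence criterion (free orbit).**  `M` a representation of `Z` on `S` over a field of
characteristic `0` in which every vector is fixed by a finite-index subgroup contained in `ker χ`; operators `ρ c`
(`c ∈ L`, an additive group), an additive character `θ` of `L` and a `θ`-eigenfunctional `μ` with `μ φ₀ ≠ 0`; subgroups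
`C₀, C` of `L` with `C ⧸ (C ∩ C₀)` finite and `θ = 1` on `C₀`; and for every `z` an additive `γ` with
`γ C₀ ⊆ C₀`, `M z ∘ ρ c = ρ (γ c) ∘ M z`, and (`M z φ₀ = φ₀ ∧ χ z = 1`) or (`θ (γ c) ≠ θ c` for some `c ∈ C`).  Then
some non-zero `φ` satisfies `M z φ = χ z • φ` for all `z`. [cite: MoeglinVignerasWaldspurger1987, Chap. 3 §IV.2 Lemme (proof)] -/
theorem exists_eigenvector_of_free_orbit_of_forall_exists_finiteIndex
    (hsm : ∀ φ : S, ∃ U : Subgroup Z, U.FiniteIndex ∧ U ≤ χ.ker ∧ ∀ u ∈ U, M u φ = φ)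
    {L : Type*} [AddCommGroup L] (ρ : L → S →ₗ[k] S) (θ : AddChar L k) (μ : S →ₗ[k] k)
    (hμ : ∀ (c : L) (φ : S), μ (ρ c φ) = θ c * μ φ) {φ₀ : S} (hφ₀ : μ φ₀ ≠ 0)
    (C₀ C : AddSubgroup L) [Finite (C ⧸ C₀.addSubgroupOf C)] (hC₀θ : ∀ c ∈ C₀, θ c = 1)
    (hZ : ∀ z : Z, ∃ γ : L →+ L, (∀ c ∈ C₀, γ c ∈ C₀) ∧ (∀ (c : L) (φ : S), M z (ρ c φ) = ρ (γ c) (M z φ)) ∧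
      ((M z φ₀ = φ₀ ∧ χ z = 1) ∨ ∃ c ∈ C, θ (γ c) ≠ θ c)) :
    ∃ φ : S, φ ≠ 0 ∧ ∀ z : Z, M z φ = ((χ z : kˣ) : k) • φ := by
  classical
  set C₀' : AddSubgroup C := C₀.addSubgroupOf C with hC₀'
  haveI : Fintype (C ⧸ C₀') := Fintype.ofFinite _
  -- the test vector `φ' = Σ_{q ∈ C/C₀} θ(q̃)⁻¹ • ρ q̃ φ₀`
  set φ' : S := ∑ q : C ⧸ C₀', (θ ((q.out : C) : L))⁻¹ • ρ ((q.out : C) : L) φ₀ with hφ'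
  -- a finite-index subgroup inside `ker χ` fixing `φ₀` and every `ρ q̃ φ₀`
  choose Uv hUf hUχ hUv using hsm
  set U : Subgroup Z := Uv φ₀ ⊓ ⨅ q : C ⧸ C₀', Uv (ρ ((q.out : C) : L) φ₀) with hU
  haveI : (Uv φ₀).FiniteIndex := hUf φ₀
  haveI : ∀ q : C ⧸ C₀', (Uv (ρ ((q.out : C) : L) φ₀)).FiniteIndex := fun q => hUf _
  haveI : (⨅ q : C ⧸ C₀', Uv (ρ ((q.out : C) : L) φ₀)).FiniteIndex := Subgroup.finiteIndex_iInf fun q => hUf _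
  haveI : U.FiniteIndex := inferInstance
  haveI : Fintype (Z ⧸ U) := U.fintypeQuotientOfFiniteIndex
  have hUχ' : U ≤ χ.ker := inf_le_left.trans (hUχ φ₀)
  have hUφ₀ : ∀ u ∈ U, M u φ₀ = φ₀ := fun u hu => hUv φ₀ u (Subgroup.mem_inf.1 hu).1
  have hUφ' : ∀ u ∈ U, M u φ' = φ' := by
    intro u hu
    rw [hφ', map_sum]
    refine Finset.sum_congr rfl fun q _ => ?_
    rw [map_smul, hUv _ u (Subgroup.mem_iInf.1 (Subgroup.mem_inf.1 hu).2 q)]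
  -- the candidate: average of `φ'` against `χ⁻¹`
  set φ : S := ∑ r : Z ⧸ U, (((χ r.out)⁻¹ : kˣ) : k) • M r.out φ' with hφ
  refine ⟨φ, ?_, fun z => apply_sum_smul_out_eq_smul M χ U hUχ' hUφ' z⟩
  -- it remains to see `φ ≠ 0`; we show `μ φ ≠ 0`.
  -- (a) `μ (M z φ') = G z * μ (M z φ₀)` with `G z` the character sum
  choose γ hγC₀ hγρ hγsep using hZ
  have hθC₀' : ∀ (z : Z) (c : C), c ∈ C₀' → θ (γ z c) * (θ c)⁻¹ = 1 := by
    intro z c hc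
    have hc' : (c : L) ∈ C₀ := AddSubgroup.mem_addSubgroupOf.1 hc
    rw [hC₀θ _ hc', hC₀θ _ (hγC₀ z _ hc'), inv_one, mul_one]
  have hG : ∀ z : Z, μ (M z φ') =
      (if ∀ c : C, θ (γ z c) * (θ c)⁻¹ = 1 then (Fintype.card (C ⧸ C₀') : k) else 0) * μ (M z φ₀) := by
    intro z
    have hsum := sum_out_eq C C₀' (fun c : C => θ (γ z c) * (θ (c : L))⁻¹) (fun a b => by
        simp only [AddSubgroup.coe_add, map_add, AddChar.map_add_eq_mul, mul_inv]
        ring) (hθC₀' z)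
    rw [hφ', map_sum, map_sum]
    simp only [map_smul, smul_eq_mul, hγρ, hμ]
    rw [← hsum, Finset.sum_mul]
    refine Finset.sum_congr rfl fun q _ => ?_
    ring
  -- (b) each term of `μ φ` is `0` or `n * μ φ₀`, and the term of the trivial coset is `n * μ φ₀`
  have hterm : ∀ r : Z ⧸ U, (((χ r.out)⁻¹ : kˣ) : k) * μ (M r.out φ') = 0 ∨
      (((χ r.out)⁻¹ : kˣ) : k) * μ (M r.out φ') = (Fintype.card (C ⧸ C₀') : k) * μ φ₀ := by
    intro r
    rw [hG]
    split_ifs with h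
    · -- the character sum is trivial: then `r.out` fixes `φ₀` and `χ r.out = 1`
      rcases hγsep r.out with ⟨h1, h2⟩ | ⟨c, hc, hne⟩
      · right
        rw [h1, h2, inv_one, Units.val_one, one_mul]
      · exfalso
        have := h ⟨c, hc⟩
        rw [mul_inv_eq_one₀ (addChar_apply_ne_zero θ c)] at this
        exact hne this
    · left
      rw [zero_mul, mul_zero]
  have hone : (((χ (QuotientGroup.mk 1 : Z ⧸ U).out)⁻¹ : kˣ) : k) * μ (M (QuotientGroup.mk 1 : Z ⧸ U).out φ') =
      (Fintype.card (C ⧸ C₀') : k) * μ φ₀ := by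
    obtain ⟨u, hu⟩ := QuotientGroup.mk_out_eq_mul U (1 : Z)
    rw [one_mul] at hu
    rw [hu, hUφ' u u.2, show χ (u : Z) = 1 from hUχ' u.2, inv_one, Units.val_one, one_mul, hφ', map_sum]
    simp only [map_smul, smul_eq_mul, hμ]
    have : ∀ q : C ⧸ C₀', (θ ((q.out : C) : L))⁻¹ * (θ ((q.out : C) : L) * μ φ₀) = μ φ₀ := fun q => by
      rw [← mul_assoc, inv_mul_cancel₀ (addChar_apply_ne_zero θ _), one_mul]
    simp only [this, Finset.sum_const, Finset.card_univ, nsmul_eq_mul]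
  -- (c) `μ φ = #{r | term ≠ 0} * (n * μ φ₀) ≠ 0`
  intro hφ0
  have hμφ : μ φ = 0 := by rw [hφ0, map_zero]
  rw [hφ, map_sum] at hμφ
  simp only [map_smul, smul_eq_mul] at hμφ
  set T : Finset (Z ⧸ U) := Finset.univ.filter fun r => (((χ r.out)⁻¹ : kˣ) : k) * μ (M r.out φ') ≠ 0 with hT
  have hsumT : (∑ r : Z ⧸ U, (((χ r.out)⁻¹ : kˣ) : k) * μ (M r.out φ')) = (T.card : k) * ((Fintype.card (C ⧸ C₀') : k) * μ φ₀) := by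
    rw [← Finset.sum_filter_ne_zero, ← hT, Finset.sum_congr rfl fun r hr => ?_, Finset.sum_const, nsmul_eq_mul]
    exact ((hterm r).resolve_left (Finset.mem_filter.1 hr).2)
  have hTne : (QuotientGroup.mk 1 : Z ⧸ U) ∈ T := by
    rw [hT, Finset.mem_filter, hone]
    exact ⟨Finset.mem_univ _, mul_ne_zero (Nat.cast_ne_zero.2 Fintype.card_ne_zero) hφ₀⟩
  rw [hsumT] at hμφ
  rcases mul_eq_zero.1 hμφ with h | h
  · exact (Nat.cast_ne_zero.2 (Finset.card_ne_zero_of_mem hTne)) h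
  · rcases mul_eq_zero.1 h with h' | h'
    · exact (Nat.cast_ne_zero.2 Fintype.card_ne_zero) h'
    · exact hφ₀ h'

end Algebra

/-! ## §2. Topology: compact `Z`, smooth `M`, open `ker χ` -/

section Compact

variable {k : Type*} [Field k] [CharZero k] {Z : Type*} [Group Z] [TopologicalSpace Z] [IsTopologicalGroup Z]
  [CompactSpace Z] {S : Type*} [AddCommGroup S] [Module k S] (M : Representation k Z S) (χ : Z →* kˣ)

omit [CharZero k] in
/-- in a compact group, every vector of a smooth representation is fixed by a finite-index subgroup inside the open
`ker χ` (the open subgroup `ker χ ⊓ Stab(φ)`). [cite: BernsteinZelevinsky1976, §2.3] -/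
theorem exists_finiteIndex_le_ker_of_isSmooth (hM : M.IsSmooth) (hχ : IsOpen (χ.ker : Set Z)) (φ : S) :
    ∃ U : Subgroup Z, U.FiniteIndex ∧ U ≤ χ.ker ∧ ∀ u ∈ U, M u φ = φ := by
  set K : Subgroup Z := χ.ker ⊓ M.stabilizerSubgroup φ with hK
  have hKo : IsOpen (K : Set Z) := hχ.inter (hM φ)
  haveI : Finite (Z ⧸ K) := Subgroup.quotient_finite_of_isOpen K hKo
  exact ⟨K, Subgroup.finiteIndex_of_finite_quotient, inf_le_left, fun u hu =>
    (M.mem_stabilizerSubgroup φ u).1 (Subgroup.mem_inf.1 hu).2⟩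

/-- **Occurrence criterion (free orbit), topological form.**  `Z` compact, `M` smooth, `ker χ` open, `char k = 0`;
`ρ`, `θ`, `μ`, `φ₀`, `C₀`, `C` and the per-`z` normalising maps `γ` as in
`exists_eigenvector_of_free_orbit_of_forall_exists_finiteIndex`.  Then `χ` occurs in `S`: some non-zero `φ` has
`M z φ = χ z • φ` for all `z`. [cite: MoeglinVignerasWaldspurger1987, Chap. 3 §IV.2 Lemme (proof)] -/
theorem exists_eigenvector_of_free_orbit (hM : M.IsSmooth) (hχ : IsOpen (χ.ker : Set Z))
    {L : Type*} [AddCommGroup L] (ρ : L → S →ₗ[k] S) (θ : AddChar L k) (μ : S →ₗ[k] k)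
    (hμ : ∀ (c : L) (φ : S), μ (ρ c φ) = θ c * μ φ) {φ₀ : S} (hφ₀ : μ φ₀ ≠ 0)
    (C₀ C : AddSubgroup L) [Finite (C ⧸ C₀.addSubgroupOf C)] (hC₀θ : ∀ c ∈ C₀, θ c = 1)
    (hZ : ∀ z : Z, ∃ γ : L →+ L, (∀ c ∈ C₀, γ c ∈ C₀) ∧ (∀ (c : L) (φ : S), M z (ρ c φ) = ρ (γ c) (M z φ)) ∧
      ((M z φ₀ = φ₀ ∧ χ z = 1) ∨ ∃ c ∈ C, θ (γ c) ≠ θ c)) :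
    ∃ φ : S, φ ≠ 0 ∧ ∀ z : Z, M z φ = ((χ z : kˣ) : k) • φ :=
  exists_eigenvector_of_free_orbit_of_forall_exists_finiteIndex M χ
    (exists_finiteIndex_le_ker_of_isSmooth M χ hM hχ) ρ θ μ hμ hφ₀ C₀ C hC₀θ hZ

/-- **Non-vanishing of the `χ`-coinvariants (free orbit).**  Under the hypotheses of
`exists_eigenvector_of_free_orbit`, the `χ`-coinvariants `Coinv M χ` are non-zero: the `χ`-eigenvector survives in
them (`mk_ne_zero_of_eigenvector`). [cite: MoeglinVignerasWaldspurger1987, Chap. 3 §IV.2 Lemme] -/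
theorem nontrivial_coinv_of_free_orbit (hM : M.IsSmooth) (hχ : IsOpen (χ.ker : Set Z))
    {L : Type*} [AddCommGroup L] (ρ : L → S →ₗ[k] S) (θ : AddChar L k) (μ : S →ₗ[k] k)
    (hμ : ∀ (c : L) (φ : S), μ (ρ c φ) = θ c * μ φ) {φ₀ : S} (hφ₀ : μ φ₀ ≠ 0)
    (C₀ C : AddSubgroup L) [Finite (C ⧸ C₀.addSubgroupOf C)] (hC₀θ : ∀ c ∈ C₀, θ c = 1)
    (hZ : ∀ z : Z, ∃ γ : L →+ L, (∀ c ∈ C₀, γ c ∈ C₀) ∧ (∀ (c : L) (φ : S), M z (ρ c φ) = ρ (γ c) (M z φ)) ∧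
      ((M z φ₀ = φ₀ ∧ χ z = 1) ∨ ∃ c ∈ C, θ (γ c) ≠ θ c)) :
    Nontrivial (Coinv M χ) := by
  obtain ⟨φ, hφ0, hφ⟩ := exists_eigenvector_of_free_orbit M χ hM hχ ρ θ μ hμ hφ₀ C₀ C hC₀θ hZ
  exact nontrivial_of_ne _ _ (mk_ne_zero_of_eigenvector M χ hM hχ hφ0 hφ)

end Compact

end Literature.RepresentationTheory.TwistedCoinv

end
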